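import Literature.Geometry.DiscreteGeometry.ThreePointEnergyBound
import Summits.Ventures.PackingBounds.Energy.CrossPolytopeUniversal
import Summits.Ventures.PackingBounds.Energy.TenPointCkTenSOS
import Summits.Ventures.PackingBounds.Energy.TenPointCkTenFsum
import Summits.Ventures.PackingBounds.Energy.TenPointCkTenBound
import HarnessLib

/-!
# Ten points on `S³`: the sharp bound `470792935/1679616` for `Σ (1 + ⟪x,y⟫)^10` by an exact three-point certificate

Framing: lottery ticket; floor = certified bounds/negative ranges. Venture `PackingBounds`, cell
`pub-packcert`, energy family E3PT (pub-packcert-energy gen 13; n = 4 kernel route = KERNEL-D6 data route + `threePointF 4`).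

For every set `C` of ten unit vectors of `ℝ⁴`, `Σ_{x ≠ y} (1 + ⟪x,y⟫)^10` over ordered pairs is at least `470792935/1679616`, the value of the
Petersen code (4,10,1/6) (inner products `1/6` and `-2/3`). Cohn–Woo (J. AMS 2012, §5.3) report this case of their three-point bound as sharp and
'provable' by the method of their §4; no certificate is printed there. The proof here is an exact sharp Bachoc–Vallentin / Cohn–Woo
three-point certificate, kernel-checked: `CohnWoo.energy_ge_of_threePoint` (general `n`), `tripleSum_threePointF_nonneg` (`n = 4`), the
blockwise identities `threePointF 4 … = FexpKT10` (closed forms `QFour.Q4_<k>` of the kernels `Q 4 k`), the SOS identity of the companion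
files, and the PSD of the 77 × 77 Gram block by kernel evaluation on integer data (KERNEL-D6 route).
Source certificate `pub-packcert-energy/certs/e3pt/e3pt-sharp-n4N10ck10d6-none.json`; generator `code/e3pt/g13/e3pt_lean_n4.py`.
-/

noncomputable section

open Finset
open scoped RealInnerProductSpace

namespace Summit.Ventures.PackingBounds.Energy.TenPointCkTen

open Literature.Geometry.DiscreteGeometry Literature.Geometry.DiscreteGeometry.BachocVallentin
open Literature.Analysis.SpecialFunctions

/-- Two-point coefficients in the tree's basis `C_k^1` (`C₁ = 2w`, `C₂ = 4w² - 1`): `a₁/2`, `a₂/3`. -/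
def acoKT10 : ℕ → ℝ
  | 1 => a1KT10 / 2
  | 2 => a2KT10 / 3
  | _ => 0

/-- The two-point coefficients are nonnegative. -/
theorem aco_nonnegT10 (k : ℕ) : 0 ≤ acoKT10 k := by
  unfold acoKT10 a1KT10 a2KT10; split <;> norm_num

/-- The rank-one weights are nonnegative. -/
theorem dco_nonnegT10 (k r : ℕ) : 0 ≤ dcoKT10 k r := by
  unfold dcoKT10; split
  · exact dco0B_nonnegT10 _
  · exact dco1B_nonnegT10 _
  · exact dco2B_nonnegT10 _
  · exact dco3B_nonnegT10 _
  · exact dco4B_nonnegT10 _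
  · exact dco5B_nonnegT10 _
  · norm_num

/-- **Ten points on `S³` (sharp three-point bound).** For every ten unit vectors `C ⊂ ℝ⁴`, `Σ_{x ≠ y} (1 + ⟪x,y⟫)^10` over
ordered pairs is `≥ 470792935/1679616` — the value of the Petersen code (4,10,1/6). -/
theorem ck10_ten_points (C : Finset (EuclideanSpace ℝ (Fin 4))) (hC : ∀ x ∈ C, ‖x‖ = 1)
    (h10 : C.card = 10) :
    ((470792935 : ℝ)/1679616) ≤ ∑ x ∈ C, ∑ y ∈ C.erase x, (1 + inner ℝ x y) ^ 10 := by
  classical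
  have hA := pairSum_gegenbauer_comb_nonneg (n := 4) (by norm_num) 2 acoKT10 aco_nonnegT10 C hC
  have hF := tripleSum_threePointF_nonneg (n := 4) le_rfl 6 6 dcoKT10 dco_nonnegT10 gwKT10 C hC
  have hcard : (C.card : ℝ) = 10 := by exact_mod_cast h10
  have hAeval : ∀ w : ℝ, (∑ k ∈ range (2 + 1), acoKT10 k * gegenbauerSum ((((4 : ℕ) : ℝ) - 2) / 2) k w) = aPolyKT10 w := by
    intro w
    have h0 : acoKT10 0 = 0 := rfl
    have h1 : acoKT10 1 = a1KT10 / 2 := rfl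
    have h2 : acoKT10 2 = a2KT10 / 3 := rfl
    simp only [Finset.sum_range_succ, Finset.sum_range_zero, h0, h1, h2, gegenbauerSum_zero, gegenbauerSum_one, gegenbauerSum_two, aPolyKT10]
    push_cast
    ring
  have hineq : ∀ u v t : ℝ, -1 ≤ u → u < 1 → -1 ≤ v → v < 1 → -1 ≤ t → t < 1 →
      0 ≤ 1 + 2 * u * v * t - u ^ 2 - v ^ 2 - t ^ 2 →
      c0KT10 + ((C.card : ℝ) - 2) * threePointF 4 6 6 dcoKT10 gwKT10 u v t + threePointF 4 6 6 dcoKT10 gwKT10 u u 1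
        + threePointF 4 6 6 dcoKT10 gwKT10 v v 1 + threePointF 4 6 6 dcoKT10 gwKT10 t t 1
        + ((fun w => ∑ k ∈ range (2 + 1), acoKT10 k * gegenbauerSum ((((4 : ℕ) : ℝ) - 2) / 2) k w) u
          + (fun w => ∑ k ∈ range (2 + 1), acoKT10 k * gegenbauerSum ((((4 : ℕ) : ℝ) - 2) / 2) k w) v
          + (fun w => ∑ k ∈ range (2 + 1), acoKT10 k * gegenbauerSum ((((4 : ℕ) : ℝ) - 2) / 2) k w) t) / 3
        ≤ (pminKT10 u + pminKT10 v + pminKT10 t) / 3 := by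
    intro u v t hu1 hu2 hv1 hv2 ht1 ht2 hdet
    simp only [hAeval, hcard, threePointF_eqT10]
    have h1 := slack_nonnegT10 u v t
    linarith
  have key := CohnWoo.energy_ge_of_threePoint C hC (by omega) pminKT10 _ _ c0KT10 hA hF
    (threePointF_swap12 4 6 6 dcoKT10 gwKT10) (threePointF_swap23 4 6 6 dcoKT10 gwKT10) hineq
  simp only [hAeval, hcard, threePointF_eqT10] at key
  have hfin : ∑ x ∈ C, ∑ y ∈ C.erase x, pminKT10 (inner ℝ x y) = ∑ x ∈ C, ∑ y ∈ C.erase x, (1 + inner ℝ x y) ^ 10 :=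
    Finset.sum_congr rfl fun x _ => Finset.sum_congr rfl fun y _ => by simp only [pminKT10]; ring
  rw [hfin] at key
  linarith [key, bound_eqT10]

end Summit.Ventures.PackingBounds.Energy.TenPointCkTen
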